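import Summits.AtomisticToContinuum.Crystallization.Theorems.ChargedEnergyGapKinkBudget
import HarnessLib

/-!
(SPLIT FOR THE 400-LINE CAP by the landing lane, hand-2 g40: this file = part 1 of 2; sequels `…ChargedEnergyGapKinkCertA` import it in a chain; same namespace, all FQNs unchanged.)
# ChargedEnergyGap · NODE 85 «KinkCert / MountainLaw» (lens-3 g84) — file A: the key-in-the-middle clause of (Σ₃) for key columns 4–6, PROVED

Line of record `stmt-AtomisticToContinuum-14231` (`Summit.AtomisticToContinuum.ChargedEnergyGap`), route PricedLinkCensus; namespace
`…Theorems.ChargedEnergyGapChartDial`.  NODE 84 (g83, in the tree: `…ChargedEnergyGapKinkBudget{A,B,C,D,}`) left ONE open leaf, the finite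
three-hole system (Σ₃) `ThreeHoleSystemQ (679/1000) (691/1000)` (file D): three marked holes `1 < 2 < 3` with hole data `(eᵢ, mᵢ, aᵢ, bᵢ, kᵢ)`, two
even gaps `n₁, n₂` in the window `ρ(n₁ + n₂) ≤ 160 + 2ρ`, legs and parabolas ⟹ `ThreeHoleGoal` (three clauses, one per position of the key = the
hole of largest kink).

THIS FILE proves the SECOND clause (key = the MIDDLE hole) whenever the key's kink column is `4, 5` or `6` (`kc_middle_high`), for every
`0 < ρ ≤ 1`, by the MOUNTAIN LAW:

* §A1 `kc_mountain_side`: the two parabolas of one gap, `ρ²n² − (ρ² + X)n + c ≥ 0` and `ρ²n² − (ρ² + Y)n − c ≥ 0` with `Y ≥ 0`, force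
  `ρ² + X ≤ ρ²n + ρ√c⁺` — a gap costs at least `1 + X/ρ²` steps minus the "mountain credit" `√(c⁺)/ρ` of the key's extra squared depth `c`;
  `kc_turn_cost`: the key's own two kink costs are `A₂ + B₂ ≥ k₂ρ(2e₂ − ρ)`; summed over the two gaps inside the window:
  ★ `kc_window_law : k₂(2e₂ − ρ) ≤ 160 + √⁺(e₂² − e₁²) + √⁺(e₂² − e₃²)` and (with the legs) `kc_key_cap : k₂(2e₂ − ρ) ≤ 320`;
* §A2 kernel-checked table certificates (`decide +kernel`, standard axioms): the PAIR-DEPTH certificate `kcPairCert j E T` (for every two table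
  rows of the outer holes, either the row maxima over columns `≤ j` sum to `≤ E = E(j, 3)`, or the squared lower row edges sum to `≥ T`; true for
  `(j, E, T) = (4, 16.7, 24212.5), (5, 18.7, 24181.25), (6, 23.2, 23949.25)`) and the INTERVAL-CHAIN certificate `kcChainCert κ T lo q₀ cuts`
  (on each key-depth interval `[p, q]` of the chain the kink credit `κ(2p − 1) − 160` beats the mountain credit `√(2·max(2q² − T, q² − lo², 0))`,
  exact rational arithmetic; `κ = 1.2, 1.3, 1.4` = the lower kink edge of columns `4, 5, 6`, `lo = 93.5` = the depth floor of a charged hole);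
* §A3 `kc_middle_high`: for a violating outer pair the table gives `e₁² + e₃² ≥ T`, the cap gives `e₂ ≤ q₀`, and the chain exhausts `[93.5, q₀]`.

Margins (num/RESULTS-g84.md, num/certcheck.py): the tightest chain inequality has slack `16.0` in units of `(credit)²` out of `≈ 9560`; the
measured geometric slack of these cases is `40 / 97 / 156` window steps (j = 4 / 5 / 6).  NOT covered here (the residual of NODE 85, main file):
key in the middle with column `3` (measured slack `3.3–4` steps — needs exact roots / branch-and-bound) and key at an END hole (slack `≥ 15.7`).

Imports ONLY `…ChargedEnergyGapKinkBudget` and `HarnessLib`; no `set_option`, no `sorry`, no instance, no notation, no `private`; `decide +kernel`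
only in the nine certificate / table-entry cells of §A2.
-/

noncomputable section

open scoped Classical
open Literature.MathematicalPhysics.StatisticalMechanics Literature.Geometry.DiscreteGeometry
open Summit.AtomisticToContinuum.Crystallization.Theses.PricedLinkCensus
open Summit.AtomisticToContinuum.Crystallization.Theorems.ChargedEnergyGapNegative

namespace Summit.AtomisticToContinuum.Crystallization.Theorems.ChargedEnergyGapChartDial

/-! ## §A1 The mountain law -/

section Mountain

/-- ★★ **MOUNTAIN LAW, one side**: the forward and backward parabola inequalities of one gap of `n > 0` steps — `ρ²n² − (ρ² + X)n + c ≥ 0` and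
`ρ²n² − (ρ² + Y)n − c ≥ 0` with `Y ≥ 0` (`X` = the kink cost paid at the key's side of the gap, `c` = key's squared depth minus the far
hole's) — give `ρ² + X ≤ ρ²n + ρ√c` (`√c = 0` for `c ≤ 0`).  Proof: if `t := ρ² + X − ρ²n > 0` then `nt ≤ c`, so `c > 0`, and `ρ²n² ≥ c` from
the second inequality; hence `t ≤ c/n = √c·(√c/n) ≤ √c·ρ`. -/
theorem kc_mountain_side {ρ n X Y c : ℝ} (hρ : 0 < ρ) (hn : 0 < n) (hY : 0 ≤ Y)
    (h1 : 0 ≤ ρ ^ 2 * n ^ 2 - (ρ ^ 2 + X) * n + c) (h2 : 0 ≤ ρ ^ 2 * n ^ 2 - (ρ ^ 2 + Y) * n - c) :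
    ρ ^ 2 + X ≤ ρ ^ 2 * n + ρ * Real.sqrt c := by
  have hs0 : 0 ≤ Real.sqrt c := Real.sqrt_nonneg c
  rcases le_or_gt (ρ ^ 2 + X - ρ ^ 2 * n) 0 with ht | ht
  · nlinarith [mul_nonneg hρ.le hs0]
  · change 0 < ρ ^ 2 + X - ρ ^ 2 * n at ht
    have hc : n * (ρ ^ 2 + X - ρ ^ 2 * n) ≤ c := by linarith
    have hc0 : 0 < c := lt_of_lt_of_le (mul_pos hn ht) hc
    have hsq : Real.sqrt c ^ 2 = c := Real.sq_sqrt hc0.le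
    have hρn : Real.sqrt c ≤ ρ * n := by
      have hle : c ≤ (ρ * n) ^ 2 := by nlinarith [mul_nonneg hn.le hY]
      calc Real.sqrt c ≤ Real.sqrt ((ρ * n) ^ 2) := Real.sqrt_le_sqrt hle
        _ = ρ * n := Real.sqrt_sq (by positivity)
    have h3 : n * (ρ ^ 2 + X - ρ ^ 2 * n) ≤ n * (ρ * Real.sqrt c) := by
      nlinarith [mul_le_mul_of_nonneg_left hρn hs0]
    have h4 := le_of_mul_le_mul_left h3 hn
    linarith

/-- ★ **TURN COST**: a hole of depth `e` with one-sided steps `0 ≤ a, b ≤ ρ` and kink `k` (`a + b = kρ`) pays `a(2e − a) + b(2e − b) ≥ kρ(2e − ρ)`. -/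
theorem kc_turn_cost {ρ e a b k : ℝ} (ha0 : 0 ≤ a) (ha : a ≤ ρ) (hb0 : 0 ≤ b) (hb : b ≤ ρ) (hk : a + b = k * ρ) :
    k * ρ * (2 * e - ρ) ≤ a * (2 * e - a) + b * (2 * e - b) := by
  rw [show k * ρ * (2 * e - ρ) = (a + b) * (2 * e - ρ) by rw [hk]]
  nlinarith [mul_nonneg ha0 (sub_nonneg.2 ha), mul_nonneg hb0 (sub_nonneg.2 hb)]

/-- ★★★ **THE WINDOW LAW** (key in the middle): summing the mountain law over the two gaps (`X = B₂` on gap `1`, `X = A₂` on gap `2`), the turn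
cost at the key and the window `ρ(n₁ + n₂) ≤ 160 + 2ρ` give `k₂(2e₂ − ρ) ≤ 160 + √⁺(e₂² − e₁²) + √⁺(e₂² − e₃²)`. -/
theorem kc_window_law {ρ n₁ n₂ e₁ a₁ e₂ a₂ b₂ k₂ e₃ b₃ : ℝ} (hρ : 0 < ρ) (hn₁ : 1 ≤ n₁) (hn₂ : 1 ≤ n₂)
    (hw : ρ * (n₁ + n₂) ≤ 160 + 2 * ρ)
    (ha₂0 : 0 ≤ a₂) (ha₂ : a₂ ≤ ρ) (hb₂0 : 0 ≤ b₂) (hb₂ : b₂ ≤ ρ) (hk₂ : a₂ + b₂ = k₂ * ρ)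
    (hA₁ : 0 ≤ a₁ * (2 * e₁ - a₁)) (hB₃ : 0 ≤ b₃ * (2 * e₃ - b₃))
    (hF₁ : e₂ ^ 2 ≤ e₁ ^ 2 - n₁ * (a₁ * (2 * e₁ - a₁)) + ρ ^ 2 * n₁ * (n₁ - 1))
    (hB₁ : e₁ ^ 2 ≤ e₂ ^ 2 - n₁ * (b₂ * (2 * e₂ - b₂)) + ρ ^ 2 * n₁ * (n₁ - 1))
    (hF₂ : e₃ ^ 2 ≤ e₂ ^ 2 - n₂ * (a₂ * (2 * e₂ - a₂)) + ρ ^ 2 * n₂ * (n₂ - 1))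
    (hB₂ : e₂ ^ 2 ≤ e₃ ^ 2 - n₂ * (b₃ * (2 * e₃ - b₃)) + ρ ^ 2 * n₂ * (n₂ - 1)) :
    k₂ * (2 * e₂ - ρ) ≤ 160 + Real.sqrt (e₂ ^ 2 - e₁ ^ 2) + Real.sqrt (e₂ ^ 2 - e₃ ^ 2) := by
  have hML1 := kc_mountain_side (n := n₁) (X := b₂ * (2 * e₂ - b₂)) (c := e₂ ^ 2 - e₁ ^ 2) hρ (by linarith) hA₁
    (by linarith) (by linarith)
  have hML2 := kc_mountain_side (n := n₂) (X := a₂ * (2 * e₂ - a₂)) (c := e₂ ^ 2 - e₃ ^ 2) hρ (by linarith) hB₃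
    (by linarith) (by linarith)
  have hturn := kc_turn_cost (e := e₂) ha₂0 ha₂ hb₂0 hb₂ hk₂
  have hwρ := mul_le_mul_of_nonneg_left hw hρ.le
  have h : ρ * (k₂ * (2 * e₂ - ρ)) ≤ ρ * (160 + Real.sqrt (e₂ ^ 2 - e₁ ^ 2) + Real.sqrt (e₂ ^ 2 - e₃ ^ 2)) := by
    nlinarith
  exact le_of_mul_le_mul_left h hρ

/-- ★ **KEY-DEPTH CAP**: the two legs, the window and the turn cost give `k₂(2e₂ − ρ) ≤ 320` (so `e₂ ≤ 160/k₂ + ρ/2`). -/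
theorem kc_key_cap {ρ n₁ n₂ e₁ a₁ e₂ a₂ b₂ k₂ e₃ b₃ : ℝ} (hρ : 0 < ρ) (hw : ρ * (n₁ + n₂) ≤ 160 + 2 * ρ)
    (ha₂0 : 0 ≤ a₂) (ha₂ : a₂ ≤ ρ) (hb₂0 : 0 ≤ b₂) (hb₂ : b₂ ≤ ρ) (hk₂ : a₂ + b₂ = k₂ * ρ)
    (hA₁ : 0 ≤ a₁ * (2 * e₁ - a₁)) (hB₃ : 0 ≤ b₃ * (2 * e₃ - b₃))
    (hL₁ : a₁ * (2 * e₁ - a₁) + b₂ * (2 * e₂ - b₂) ≤ 2 * ρ ^ 2 * (n₁ - 1))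
    (hL₂ : a₂ * (2 * e₂ - a₂) + b₃ * (2 * e₃ - b₃) ≤ 2 * ρ ^ 2 * (n₂ - 1)) :
    k₂ * (2 * e₂ - ρ) ≤ 320 := by
  have hturn := kc_turn_cost (e := e₂) ha₂0 ha₂ hb₂0 hb₂ hk₂
  have hwρ := mul_le_mul_of_nonneg_left hw (by positivity : (0 : ℝ) ≤ 2 * ρ)
  have h : ρ * (k₂ * (2 * e₂ - ρ)) ≤ ρ * 320 := by nlinarith
  exact le_of_mul_le_mul_left h hρ

/-- The two mountain credits together: if `x, y, x + y ≤ V` and `0 ≤ V` then `(√x + √y)² ≤ 2V` (`√` = `Real.sqrt`, zero on negatives).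
[formal bookkeeping] -/
theorem kc_sqrt_pair_sq {x y V : ℝ} (hV0 : 0 ≤ V) (h1 : x ≤ V) (h2 : y ≤ V) (h12 : x + y ≤ V) :
    (Real.sqrt x + Real.sqrt y) ^ 2 ≤ 2 * V := by
  have key : Real.sqrt x ^ 2 + Real.sqrt y ^ 2 ≤ V := by
    rcases le_or_gt 0 x with hx | hx <;> rcases le_or_gt 0 y with hy | hy
    · rw [Real.sq_sqrt hx, Real.sq_sqrt hy]; exact h12
    · rw [Real.sq_sqrt hx, Real.sqrt_eq_zero'.2 (le_of_lt hy)]; simpa using h1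
    · rw [Real.sqrt_eq_zero'.2 (le_of_lt hx), Real.sq_sqrt hy]; simpa using h2
    · rw [Real.sqrt_eq_zero'.2 (le_of_lt hx), Real.sqrt_eq_zero'.2 (le_of_lt hy)]; simpa using hV0
  nlinarith [sq_nonneg (Real.sqrt x - Real.sqrt y)]

/-- ★ **ONE INTERVAL OF THE CHAIN**: on a key-depth interval `p ≤ e₂ ≤ q` where the kink credit `κ(2p − 1) − 160 > 0` beats the mountain credit,
`(κ(2p − 1) − 160)² > 2·max(2q² − T, q² − lo², 0)` (`κ ≤ k₂`, `lo ≤ e₁, e₃`, `T ≤ e₁² + e₃²`, `ρ ≤ 1`), the window law is violated. -/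
theorem kc_interval {κ T lo p q ρ k₂ e₁ e₂ e₃ : ℝ} (hρ1 : ρ ≤ 1) (hκ : κ ≤ k₂) (hκ0 : 0 ≤ κ)
    (hlo0 : 0 ≤ lo) (he₁ : lo ≤ e₁) (he₃ : lo ≤ e₃) (hlo₂ : lo ≤ e₂) (hp : p ≤ e₂) (hq : e₂ ≤ q)
    (hT : T ≤ e₁ ^ 2 + e₃ ^ 2)
    (hW : k₂ * (2 * e₂ - ρ) ≤ 160 + Real.sqrt (e₂ ^ 2 - e₁ ^ 2) + Real.sqrt (e₂ ^ 2 - e₃ ^ 2))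
    (hc : 160 < κ * (2 * p - 1))
    (hV : 2 * max (2 * (q * q) - T) (max (q * q - lo * lo) 0) < (κ * (2 * p - 1) - 160) * (κ * (2 * p - 1) - 160)) : False := by
  set V : ℝ := max (2 * (q * q) - T) (max (q * q - lo * lo) 0) with hVdef
  set S : ℝ := Real.sqrt (e₂ ^ 2 - e₁ ^ 2) + Real.sqrt (e₂ ^ 2 - e₃ ^ 2) with hSdef
  have hV0 : 0 ≤ V := le_trans (le_max_right _ _) (le_max_right _ _)
  have hVa : q * q - lo * lo ≤ V := le_trans (le_max_left _ _) (le_max_right _ _)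
  have hVb : 2 * (q * q) - T ≤ V := le_max_left _ _
  have he₂0 : 0 ≤ e₂ := le_trans hlo0 hlo₂
  have he2q : e₂ * e₂ ≤ q * q := mul_le_mul hq hq he₂0 (he₂0.trans hq)
  have hl1 : lo * lo ≤ e₁ * e₁ := mul_le_mul he₁ he₁ hlo0 (hlo0.trans he₁)
  have hl3 : lo * lo ≤ e₃ * e₃ := mul_le_mul he₃ he₃ hlo0 (hlo0.trans he₃)
  have hS2 : S ^ 2 ≤ 2 * V :=
    kc_sqrt_pair_sq hV0 (by nlinarith) (by nlinarith) (by nlinarith)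
  have hS0 : 0 ≤ S := add_nonneg (Real.sqrt_nonneg _) (Real.sqrt_nonneg _)
  have hc0 : 0 < κ * (2 * p - 1) - 160 := by linarith
  have hSc : S < κ * (2 * p - 1) - 160 := by
    rcases lt_or_ge S (κ * (2 * p - 1) - 160) with h | hge
    · exact h
    · have := mul_self_le_mul_self hc0.le hge
      nlinarith
  have hp1 : 0 < 2 * p - 1 := by
    rcases lt_or_ge 0 (2 * p - 1) with h | hneg
    · exact h
    · have := mul_nonpos_of_nonneg_of_nonpos hκ0 hneg
      linarith
  have hA : κ * (2 * p - 1) ≤ κ * (2 * e₂ - ρ) := mul_le_mul_of_nonneg_left (by linarith) hκ0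
  have hB : κ * (2 * e₂ - ρ) ≤ k₂ * (2 * e₂ - ρ) := mul_le_mul_of_nonneg_right hκ (by linarith)
  linarith

end Mountain

/-! ## §A2 Kernel-checked table certificates and their reading -/

section Tables

/-- Lower edge of table row `r ≥ 1` of the kink-cost table (`r ≤ 73` ⇔ min-depth `∈ [93.5 + (r−1)/2, 93.5 + r/2)`; row `74` ⇔ `[130, 140)`). -/
def kcRowLo (r : ℕ) : ℚ :=
  if r ≤ 73 then 187 / 2 + ((r : ℚ) - 1) / 2 else 130

/-- Row maximum of the kink-cost table `capKRows` over columns `0 … j`. -/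
def kcRowMax (j r : ℕ) : ℚ :=
  ((List.range (j + 1)).map fun c => (capKRows.getD r []).getD c 0).foldr max 0

/-- CERTIFICATE SHAPE (pair depth): for every two table rows `r₁, r₃ ∈ 1 … 74`, either the two row maxima over columns `≤ j` sum to `≤ E`, or
the squared lower row edges sum to `≥ T`. -/
def kcPairCert (j : ℕ) (E T : ℚ) : Bool :=
  (List.range 74).all fun i => (List.range 74).all fun i' =>
    decide (kcRowMax j (i + 1) + kcRowMax j (i' + 1) ≤ E) || decide (T ≤ kcRowLo (i + 1) * kcRowLo (i + 1) + kcRowLo (i' + 1) * kcRowLo (i' + 1))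

/-- CERTIFICATE SHAPE (interval chain): starting from the key-depth bound `q`, the cuts `p₁ > p₂ > … > p_m` each satisfy the interval inequality
of `kc_interval` on `[pᵢ, previous]`, and the last cut lies below `lo`. -/
def kcChainCert (κ T lo : ℚ) : ℚ → List ℚ → Bool
  | q, [] => decide (q < lo)
  | q, p :: rest =>
    decide (160 < κ * (2 * p - 1)) &&
      decide (2 * max (2 * (q * q) - T) (max (q * q - lo * lo) 0) < (κ * (2 * p - 1) - 160) * (κ * (2 * p - 1) - 160)) &&
        kcChainCert κ T lo p rest

/-- Pair-depth certificate, key column `4`: `E(4, 3) = 16.7`, `T₄ = 24212.5`. [kernel decision] -/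
theorem kcPair4_true : kcPairCert 4 (167 / 10) (48425 / 2) = true := by
  decide +kernel

/-- Pair-depth certificate, key column `5`: `E(5, 3) = 18.7`, `T₅ = 24181.25`. [kernel decision] -/
theorem kcPair5_true : kcPairCert 5 (187 / 10) (96725 / 4) = true := by
  decide +kernel

/-- Pair-depth certificate, key column `6`: `E(6, 3) = 23.2`, `T₆ = 23949.25`. [kernel decision] -/
theorem kcPair6_true : kcPairCert 6 (116 / 5) (95797 / 4) = true := by
  decide +kernel

/-- Interval chain, key column `4` (`κ = 1.2`): cuts `133.9 > 130.8 > 126.2 > 118.7 > 110.3 > 101.7 > 93`. [kernel decision] -/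
theorem kcChain4_true :
    kcChainCert (6 / 5) (48425 / 2) (187 / 2) (1339 / 10) [654 / 5, 631 / 5, 1187 / 10, 1103 / 10, 1017 / 10, 93] = true := by
  decide +kernel

/-- Interval chain, key column `5` (`κ = 1.3`): cuts `123.6 > 106.1 > 93`. [kernel decision] -/
theorem kcChain5_true : kcChainCert (13 / 10) (96725 / 4) (187 / 2) (618 / 5) [1061 / 10, 93] = true := by
  decide +kernel

/-- Interval chain, key column `6` (`κ = 1.4`): cuts `114.8 > 93`. [kernel decision] -/
theorem kcChain6_true : kcChainCert (7 / 5) (95797 / 4) (187 / 2) (574 / 5) [93] = true := by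
  decide +kernel

/-- Line-excess entry `E(4, 3) = 16.7`. [kernel decision] -/
theorem kc_lineE1_4 : (lineExcessRows.getD 1 []).getD 4 0 = 167 / 10 := by
  decide +kernel

/-- Line-excess entry `E(5, 3) = 18.7`. [kernel decision] -/
theorem kc_lineE1_5 : (lineExcessRows.getD 1 []).getD 5 0 = 187 / 10 := by
  decide +kernel

/-- Line-excess entry `E(6, 3) = 23.2`. [kernel decision] -/
theorem kc_lineE1_6 : (lineExcessRows.getD 1 []).getD 6 0 = 116 / 5 := by
  decide +kernel

/-- `E(j, 3)` as a real lower bound, `j = 4, 5, 6`. [formal bookkeeping] -/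
theorem kc_lineExcess_three (j : ℕ) : (((lineExcessRows.getD 1 []).getD j 0 : ℚ) : ℝ) ≤ lineExcess j 3 := by
  unfold lineExcess
  rw [if_neg (by omega), if_neg (by omega)]
  exact le_max_right _ _

/-- A member's value is below the `foldr max 0`. [formal bookkeeping] -/
theorem kc_le_foldr_max {l : List ℕ} {c : ℕ} (f : ℕ → ℚ) (hc : c ∈ l) : f c ≤ (l.map f).foldr max 0 := by
  induction l with
  | nil => exact absurd hc (by simp)
  | cons x l ih =>
    rw [List.map_cons, List.foldr_cons]
    rcases List.mem_cons.1 hc with h | h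
    · rw [h]; exact le_max_left _ _
    · exact le_trans (ih h) (le_max_right _ _)

/-- `foldr max 0` is non-negative. [formal bookkeeping]  (Landing lane, hand-2 g40: made `private` — near-duplicate token; the statement coincides
with a bookkeeping lemma of another summit (`…SignCone.SchurCert.foldr_max_nonneg`) that cannot be imported here, reviewer: «acceptable as is».) -/
private theorem kc_foldr_max_nonneg (l : List ℚ) : 0 ≤ l.foldr max 0 := by
  induction l with
  | nil => exact le_rfl
  | cons x l ih => rw [List.foldr_cons]; exact le_trans ih (le_max_right _ _)

/-- A table cell of column `≤ j` is below the row maximum. [formal bookkeeping] -/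
theorem kc_le_rowMax (j r c : ℕ) (hc : c ≤ j) : (capKRows.getD r []).getD c 0 ≤ kcRowMax j r := by
  unfold kcRowMax
  exact kc_le_foldr_max (fun c => (capKRows.getD r []).getD c 0) (List.mem_range.2 (by omega))

/-- Row maxima are non-negative. [formal bookkeeping] -/
theorem kc_rowMax_nonneg (j r : ℕ) : 0 ≤ kcRowMax j r := by
  unfold kcRowMax
  exact kc_foldr_max_nonneg _

/-- ★ From the kink column to the row maximum: a hole of kink column `≤ j` carries at most the row maximum over columns `≤ j`. -/
theorem kc_capK_le_rowMax (d J : ℝ) {j : ℕ} (hc : capKCol J ≤ j) : capK d J ≤ ((kcRowMax j (capKRow d) : ℚ) : ℝ) := by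
  have h0 : (0 : ℝ) ≤ ((kcRowMax j (capKRow d) : ℚ) : ℝ) := by exact_mod_cast kc_rowMax_nonneg j (capKRow d)
  unfold capK
  split_ifs
  · exact h0
  · exact max_le h0 (by exact_mod_cast kc_le_rowMax j (capKRow d) (capKCol J) hc)

/-- Reading the pair-depth certificate. [formal bookkeeping] -/
theorem kc_pair_read {j : ℕ} {E T : ℚ} (h : kcPairCert j E T = true) {r₁ r₃ : ℕ} (h1 : 1 ≤ r₁) (h1' : r₁ ≤ 74) (h3 : 1 ≤ r₃)
    (h3' : r₃ ≤ 74) :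
    kcRowMax j r₁ + kcRowMax j r₃ ≤ E ∨ T ≤ kcRowLo r₁ * kcRowLo r₁ + kcRowLo r₃ * kcRowLo r₃ := by
  unfold kcPairCert at h
  rw [List.all_eq_true] at h
  have h' := h (r₁ - 1) (List.mem_range.2 (by omega))
  rw [List.all_eq_true] at h'
  have h'' := h' (r₃ - 1) (List.mem_range.2 (by omega))
  rw [show r₁ - 1 + 1 = r₁ by omega, show r₃ - 1 + 1 = r₃ by omega, Bool.or_eq_true_iff, decide_eq_true_iff,
    decide_eq_true_iff] at h''
  exact h''

-- (Landing lane, hand-2 g40, reviewer revise on p854287: the lens's `kc_lo_le_of_row` — «a charged hole (table row ≥ 1) has min-depth ≥ 93.5» —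
-- duplicated TREE `fc_le_of_capKRow` (…ChargedEnergyGapFibreChargeA, same namespace, in scope through the import chain) verbatim; deleted, and its uses
-- here and in part 2 cite `fc_le_of_capKRow` instead.)

/-- ★ The lower row edge is below the min-depth (rows `≥ 1`). [formal bookkeeping] -/
theorem kc_rowLo_le (d : ℝ) (h : 1 ≤ capKRow d) : ((kcRowLo (capKRow d) : ℚ) : ℝ) ≤ d := by
  have hd := fc_le_of_capKRow d h
  by_cases h130 : d < 130
  · have hr : capKRow d = 1 + ⌊(d - 187 / 2) * 2⌋₊ := by
      unfold capKRow
      rw [if_neg (not_lt.2 hd), if_pos h130]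
    have hfl : (⌊(d - 187 / 2) * 2⌋₊ : ℝ) ≤ (d - 187 / 2) * 2 := Nat.floor_le (by linarith)
    have h73 : 1 + ⌊(d - 187 / 2) * 2⌋₊ ≤ 73 := by
      have : ⌊(d - 187 / 2) * 2⌋₊ < 73 := (Nat.floor_lt (by linarith)).2 (by push_cast; linarith)
      omega
    rw [hr]
    unfold kcRowLo
    rw [if_pos h73]
    push_cast
    linarith
  · have h130 := not_lt.1 h130
    have hr : capKRow d = 74 := by
      unfold capKRow
      rw [if_neg (by linarith), if_neg (not_lt.2 h130)]
    rw [hr]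
    unfold kcRowLo
    rw [if_neg (by norm_num)]
    push_cast
    linarith

/-- Lower row edges are non-negative. [formal bookkeeping] -/
theorem kc_rowLo_nonneg (r : ℕ) : 0 ≤ kcRowLo r := by
  unfold kcRowLo
  split_ifs
  · have : (0 : ℚ) ≤ r := Nat.cast_nonneg r
    linarith
  · norm_num

/-- ★ **SOUNDNESS OF THE INTERVAL CHAIN**: a certified chain from `q` exhausts the key depths `lo ≤ e₂ ≤ q` — under the window law, `κ ≤ k₂`,
`lo ≤ e₁, e₃`, `T ≤ e₁² + e₃²`, `ρ ≤ 1`, there is no such `e₂`. -/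
theorem kc_chain_sound {κ T lo : ℚ} (cuts : List ℚ) :
    ∀ (q : ℚ), kcChainCert κ T lo q cuts = true →
      ∀ {ρ k₂ e₁ e₂ e₃ : ℝ}, ρ ≤ 1 → (κ : ℝ) ≤ k₂ → (0 : ℝ) ≤ κ → (0 : ℝ) ≤ lo → (lo : ℝ) ≤ e₁ → (lo : ℝ) ≤ e₃ →
        (lo : ℝ) ≤ e₂ → e₂ ≤ (q : ℝ) → (T : ℝ) ≤ e₁ ^ 2 + e₃ ^ 2 →
          k₂ * (2 * e₂ - ρ) ≤ 160 + Real.sqrt (e₂ ^ 2 - e₁ ^ 2) + Real.sqrt (e₂ ^ 2 - e₃ ^ 2) → False := by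
  induction cuts with
  | nil =>
    intro q h ρ k₂ e₁ e₂ e₃ _ _ _ _ _ _ hlo₂ hq _ _
    have h' : q < lo := by simpa [kcChainCert] using h
    have h'' : (q : ℝ) < lo := by exact_mod_cast h'
    linarith
  | cons p rest ih =>
    intro q h ρ k₂ e₁ e₂ e₃ hρ1 hκ hκ0 hlo0 he₁ he₃ hlo₂ hq hT hW
    simp only [kcChainCert, Bool.and_eq_true, decide_eq_true_eq] at h
    obtain ⟨⟨hc, hV⟩, hrest⟩ := h
    rcases le_or_gt (p : ℝ) e₂ with hp | hp
    · have hc' : (160 : ℝ) < κ * (2 * p - 1) := by exact_mod_cast hc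
      have hV' : (2 : ℝ) * max (2 * ((q : ℝ) * q) - T) (max ((q : ℝ) * q - lo * lo) 0) <
          (κ * (2 * p - 1) - 160) * (κ * (2 * p - 1) - 160) := by exact_mod_cast hV
      exact kc_interval hρ1 hκ hκ0 hlo0 he₁ he₃ hlo₂ hp hq hT hW hc' hV'
    · exact ih p hrest hρ1 hκ hκ0 hlo0 he₁ he₃ hlo₂ (le_of_lt hp) hT hW

end Tables

end Summit.AtomisticToContinuum.Crystallization.Theorems.ChargedEnergyGapChartDial
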